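import Mathlib
import Literature.Analysis.FluidPDE.PartialRegularity
import Literature.Analysis.FluidPDE.AxisymmetricEuler
import HarnessLib

/-!
# Palasek 2021: double-exponential quantitative regularity for axisymmetric `L^∞_t L³_x` solutions

Named fact (statement only, `def … : Prop`), vendored for route `NavierStokesRegularity/SubcubicESS`
as the nearest printed result to its rung
`Summit.NavierStokesRegularity.NavierStokesRegularity.Theses.SubcubicESS.AxisymSubcubicBound`
(which asks for a SUB-CUBIC size function `F(A) = o(A³)` in the same class — far beyond print) and
as the axisymmetric sharpening of the tree's `tao_quantitative_ess` (Tao 2021, Thm 1.2: triple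
exponential, no symmetry):

* `palasek2021_axisym_quantitative_ess` — **Palasek, ARMA 2021 (arXiv:2101.08586), Thm 1, case
  `q = 3`, `j = 0, 1`**: an absolute constant `C > 0` such that every classical solution of the
  unforced unit-viscosity Navier–Stokes system on `[0, T] × ℝ³` in Tao's class which is
  axisymmetric and obeys `‖u‖_{L^∞_t L³_x([0,T] × ℝ³)} ≤ A`, `A ≥ 2`, satisfies
  `|u(t, x)| ≤ exp exp (A^C) t^{-1/2}` and `|∇u(t, x)| ≤ exp exp (A^C) t^{-1}` for `0 < t ≤ T`.

Printed statement (p. 4): "(critical) `‖r^{1-3/q} u‖_{L^∞_t L^q_x} ≤ A` where `u` and `q` fall into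
one of two cases: (cases) either `q ∈ (3, ∞)`, or `u` is axisymmetric and `q ∈ (2, 3]`. Without loss
of generality, let us take `A ≥ 2`. … **Theorem 1.** If `u : [0, T] × ℝ³ → ℝ³` is a classical
solution of (NS) satisfying (critical) and (cases), then it satisfies the bounds
`|∇ʲₓ u(t, x)| ≤ exp exp (A^{O(1)}) t^{-(j+1)/2}` and `|∇ʲₓ ω(t, x)| ≤ exp exp (A^{O(1)}) t^{-(j+2)/2}`
for `t ∈ (0, T]`, `x ∈ ℝ³`, and `j = 0, 1`." and "One noteworthy special case … is when `q = 3`,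
which is the famous Prodi–Serrin–Ladyzhenskaya endpoint `L^∞_t L³_x`. By assuming additionally that
`u` is axisymmetric, we obtain the same result as [Tao] but with one fewer exp or log". Here
`r = √(x₀² + x₁²)` is the distance to the `x₂`-axis, so at `q = 3` the weight `r^{1-3/q}` is `1`.
"Classical" on p. 3 means `u, p` smooth with viscosity normalised to `1`; we state the fact for
Tao's class `IsHkClassicalSolutionOn` (smooth AND all `‖∇ⁿu(t)‖_{L²}` bounded on `[0, T]`), a
stronger hypothesis, so this `def` is implied by the printed theorem; `exp exp (A^{O(1)})` is read,
as for `taoTripleExp`, as `exp exp (A^C)` for one absolute `C` (valid since `A ≥ 2`); only the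
velocity bounds `j = 0, 1` are recorded (the vorticity bounds are omitted). Axisymmetry is the
tree's `IsAxisymmetric (u t)` (equivariance under rotations about the `x₂`-axis,
`AxisymmetricEuler.lean`), imposed at every `t ∈ [0, T]`.

## References

* [Palasek2021] S. Palasek, *Improved quantitative regularity for the Navier–Stokes equations in a
  scale of critical spaces*, Arch. Ration. Mech. Anal. 242 (2021) 1479–1531, arXiv:2101.08586,
  Thm 1 and Rmk 1, pp. 3–4 — held (paper:arxiv-2101.08586, chunks 3–4 read 2026-08-15).
* [Tao2021] T. Tao, *Quantitative bounds for critically bounded solutions to the Navier–Stokes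
  equations*, arXiv:1908.04958, Thm 1.2 — the tree's `tao_quantitative_ess` (same shape, triple exp).
-/

noncomputable section

open MeasureTheory Set

namespace Literature.Analysis.FluidPDE

local notation "ℝ³" => EuclideanSpace ℝ (Fin 3)

/-- The double exponential `exp exp (A ^ C)` of Palasek 2021, Thm 1 (one exponential fewer than
`taoTripleExp`). [cite: Palasek2021, Thm 1] -/
def palasekDoubleExp (C A : ℝ) : ℝ :=
  Real.exp (Real.exp (A ^ C))

/-- Unfolding `palasekDoubleExp`. [folklore] -/
theorem palasekDoubleExp_def (C A : ℝ) : palasekDoubleExp C A = Real.exp (Real.exp (A ^ C)) :=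
  rfl

/-- The double exponential is positive. [folklore] -/
theorem palasekDoubleExp_pos (C A : ℝ) : 0 < palasekDoubleExp C A :=
  Real.exp_pos _

/-- One exponential fewer: `exp exp (A^C) ≤ exp exp exp (A^C)`. [folklore] -/
theorem palasekDoubleExp_le_taoTripleExp (C A : ℝ) : palasekDoubleExp C A ≤ taoTripleExp C A := by
  rw [palasekDoubleExp_def, taoTripleExp_def]
  exact Real.exp_le_exp.2 (Real.exp_le_exp.2 (by linarith [Real.add_one_le_exp (A ^ C)]))

/-- **Palasek 2021, Thm 1 (case `q = 3`, axisymmetric; `j = 0, 1`): double-exponential quantitative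
Escauriaza–Seregin–Šverák bound.** There is an absolute constant `C > 0` such that: if `(u, p)` is a
classical solution of the unforced Navier–Stokes system (`ν = 1`) on `[0, T] × ℝ³` in Tao's class
(`IsHkClassicalSolutionOn`), `u(t)` is axisymmetric about the `x₂`-axis for every `t ∈ [0, T]`, and
`‖u(t)‖_{L³(ℝ³)} ≤ A` for all `t ∈ [0, T]` with `A ≥ 2`, then for all `0 < t ≤ T` and `x ∈ ℝ³`,
`|u(t, x)| ≤ exp exp (A^C) · t^{-1/2}` and `|∇u(t, x)| ≤ exp exp (A^C) · t^{-1}` (printed: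
`|∇ʲₓu(t,x)| ≤ exp exp(A^{O(1)}) t^{-(j+1)/2}`, `j = 0, 1`, under `‖r^{1-3/q}u‖_{L^∞_t L^q_x} ≤ A`
with `q = 3` and `u` axisymmetric; "classical" = smooth, here strengthened to Tao's class). Nearest
print for `Summit.NavierStokesRegularity.NavierStokesRegularity.Theses.SubcubicESS.AxisymSubcubicBound`,
which it does NOT imply (that rung asks `F(A) = o(A³)`). [cite: Palasek2021, Thm 1 (q = 3, axisymmetric case) and Rmk 1, p. 4] -/
def palasek2021_axisym_quantitative_ess : Prop :=
  ∃ C : ℝ, 0 < C ∧ ∀ (T A : ℝ) (u : ℝ → ℝ³ → ℝ³) (p : ℝ → ℝ³ → ℝ),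
      IsHkClassicalSolutionOn (Icc 0 T) u p →
      (∀ t ∈ Icc 0 T, IsAxisymmetric (u t)) →
      (∀ t ∈ Icc 0 T, eLpNorm (u t) 3 volume ≤ ENNReal.ofReal A) → 2 ≤ A →
      ∀ t ∈ Ioc 0 T, ∀ x : ℝ³,
        ‖u t x‖ ≤ palasekDoubleExp C A * t ^ (-(1 / 2 : ℝ)) ∧
        ‖fderiv ℝ (u t) x‖ ≤ palasekDoubleExp C A * t ^ (-(1 : ℝ))

/-- Sanity of shape: Palasek's axisymmetric bound has exactly the form of the tree's
`tao_quantitative_ess` restricted to axisymmetric solutions, with a smaller size function; in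
particular Tao's theorem already gives the axisymmetric statement with `taoTripleExp`. [folklore] -/
theorem axisym_quantitative_ess_of_tao (h : tao_quantitative_ess) :
    ∃ C : ℝ, 0 < C ∧ ∀ (T A : ℝ) (u : ℝ → ℝ³ → ℝ³) (p : ℝ → ℝ³ → ℝ),
      IsHkClassicalSolutionOn (Icc 0 T) u p →
      (∀ t ∈ Icc 0 T, IsAxisymmetric (u t)) →
      (∀ t ∈ Icc 0 T, eLpNorm (u t) 3 volume ≤ ENNReal.ofReal A) → 2 ≤ A →
      ∀ t ∈ Ioc 0 T, ∀ x : ℝ³,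
        ‖u t x‖ ≤ taoTripleExp C A * t ^ (-(1 / 2 : ℝ)) ∧
        ‖fderiv ℝ (u t) x‖ ≤ taoTripleExp C A * t ^ (-(1 : ℝ)) := by
  obtain ⟨C, hC, h⟩ := h
  exact ⟨C, hC, fun T A u p hu _ hA h2 => h T A u p hu hA h2⟩

end Literature.Analysis.FluidPDE
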